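import Summits.HodgeConjecture.HodgeConjecture.Cruxes.BlochSeedDiscOne.SeedChecker
import Summits.HodgeConjecture.HodgeConjecture.Theses.EightfoldTwistedSheafSeeds
import Literature.AlgebraicGeometry.HodgeTheory.TwistedPerfectAdmissibilityInitialSegment
import Summits.Ventures.HSemireg.AmplificationChainAssembly
import Summits.Ventures.HSemireg.AmplificationChainSigmaGluable
import HarnessLib

/-!
# The R-B door chain, SECOND TERMINUS: the sheaf door composes BY NAME to the crux `SheafSeedGaussSq` of route № 3
# (`EightfoldTwistedSheafSeeds`, item stmt-HodgeConjecture-30548) — custody file of seat `hsemireg-sheaf8-1` (g9, 2026-08-31; v1.1)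

Token of the line of record (UNTOUCHED): `line stmt-HodgeConjecture-18881 Cruxes/BlochSeedDiscOne/Lines/birth.lean 814a6a70c14e831a
stub_rung_pad4_seedAt`.

HONEST FRAMING.  A CERTIFICATE OF WIRING, nothing else: no object is constructed, every door is hypothesis-carrying, nothing here says
HC ∕ HC_CM (HELD) ∕ HC_AV ∕ № 4 ∕ 26512 ∕ 18881 ∕ 30548 ∕ H2 is proved.  R-B ≠ 18881; an address ≠ a design ≠ a display ≠ a sheaf ≠
semiregular ≠ SEED; typed ≠ proved.

WHAT IS NEW (director-hodge R19.838 «unless you find the sheaf door's bridge to the crux in the tree — grep, do not assume»; c5c8-1 v41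
§41.5′ ∕ memo §9.3 «door S … does not reach the crux»; this seat's `RBDoorChain.lean` (g0): the chain ends at the LADDER node
`HasLocallyAlgebraicWeilAnchor 4 1` mod BF 5.1).  All three statements are about the crux `BlochSeedDiscOne` (18881, the lci door) and are
correct.  THIS FILE records the other half: the SAME sheaf-door output `HasHyperbolicBFSheafSeedOn C 4 1 I` — the common value of EVERY R-B
entrance in the tree (`CleanAtSeed`, `Design.SheafSeedCheck[R ∕ RankFree]`, kernel ∕ cokernel ∕ monad ∕ box ∕ tame presentations, v41's
`SplitBlockCore[K].PassesSheaf` and `Rung2aSheaf[K]`) — composes BY NAME, with NO named fact (no BF 5.1, no reach), to the REGISTERED crux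
of route № 3:

  `Summit.HodgeConjecture.HodgeConjecture.Theses.EightfoldTwistedSheafSeeds.SheafSeedGaussSq`
  `= ∃ m, 0 < m ∧ ∀ C, HasHyperbolicSeedOn (twistedReflexiveClass C (gluableSigmaAdmissible ∨ bfSingleAdmissible')) 4 (m ^ 2)`

at `m = 1` (the `E_i`-corner `ψ₀² = −1` IS `pad4Anchor`'s), PROVIDED the semiregularity window `I` is a SHIFTED INITIAL SEGMENT
(`Finset.IsShiftedInitialSegment`: `{q | q + 1 ∈ I}` downward closed — the conjunct that distinguishes the route's PRIMED notion
`bfSingleAdmissible'` from Buchweitz–Flenner's `bfSingleAdmissible`).  So the sheaf-door rungs 2a∕2b of the split-block ansatz (v41 `Rung2aSheaf`,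
`Rung2bSheaf`), which compose to NO decl of route № 4's crux 18881, DO have a registered crux to conclude by name: 30548 (BC6-eligible THERE).

THE WINDOW CAVEAT, typed (§3) — and DISCHARGED for every json-checker entrance (§2b, v1.1: `I`-semiregularity is monotone in `I` and
`RealisedBy` is window-free, so any passing certificate re-windows to `{1,…,8}`; `sheafSeedGaussSq_of_sheafSeedCheckRankFree'` has NO window
side condition).  For the bare `CleanAtSeed C I` ∕ `HasHyperbolicBFSheafSeedOn C 4 1 I` entrances it stands: with `4 ∈ I`, shifted-initial forces `{1,2,3,4} ⊆ I` (`icc_one_four_subset`), i.e. `σ₀, σ₁, σ₂, σ₃` ALL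
injective on `Ext²(𝓔,𝓔)` — Buchweitz–Flenner semiregularity in every degree below the seed; the bare cycle-degree window `I = {4}` (only
`σ₃ : Ext² → H⁵(Ω³)`, target `56² = 3136` — the budget of the letter model) is NOT shifted-initial (`not_isShiftedInitialSegment_four`) and
reaches the ladder node (mod BF 5.1, `RBDoorChain`) but NOT 30548 as typed.  `Finset.Icc 1 8`, `Finset.Icc 0 8 = Iic 8`, `Icc 1 4` qualify.

CONTENTS. §1 the class inclusion at a FIXED window: an `I`-semiregular vector bundle with `I` shifted-initial is a member of
`twistedReflexiveClass C AdmTwP` (`B₀ = 0`, complex `𝓔[0]`; the tree's `twistedReflexiveClass_of_isISemiregular` wants `Adm ⊇ bfSingleAdmissible`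
at EVERY window, which the primed notion is not — hence the pointwise variant); `HasBFSheafSeedOn → HasSeedOn`, `HasHyperbolicBFSheafSeedOn →
HasHyperbolicSeedOn`.  §2 the crux of route № 3 BY NAME from hyperbolic BF sheaf seeds for every `C` (`sheafSeedGaussSq_of_hyperbolicBFSheafSeedsOn`),
and from each R-B entrance (rank-free ∕ rank-`r` checker, `CleanAtSeed`, kernel presentation; v41's `Rung2aSheaf[K]` enters through its own
`hasHyperbolicBFSheafSeedOn_of_rung2aSheaf[K]`, one line, not restated here because `SeedCheckerSplitBlock` is not yet built on the farm).  §3 the window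
lemmas.  §4 audit.  No `sorry`, no new `def` carrying content (one reducible abbreviation `AdmTwP` = the route's lambda, as in
`Cruxes/SheafSeedGaussSq/Lines/secant_q824.lean`), no instance, no notation, no named fact introduced; axioms standard.

References: [BuchweitzFlenner2003] §5 (I-semiregular), Thm. 5.1; [Pridham2024Semiregularity] Rem. 2.26 with Cor. 2.25 (why the initial segment);
[Markman2025SecantWeil] §1.5, §7.3; [Deligne1982HodgeCycles] proof of Thm. 4.8.
-/

set_option linter.dupNamespace false
set_option autoImplicit false

noncomputable section

open CategoryTheory AlgebraicGeometry
open Literature.AlgebraicGeometry Literature.AlgebraicGeometry.Motives Literature.AlgebraicGeometry.HodgeTheory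
open Literature.AlgebraicGeometry.Modules
open Literature.AlgebraicTopology.SingularHomology

namespace Summit.HodgeConjecture.HodgeConjecture.Cruxes.BlochSeedDiscOne.RBDoorChainSheafCrux

open Summit.HodgeConjecture.HodgeConjecture.Cruxes.BlochSeedDiscOne.Anchor
open Summit.HodgeConjecture.HodgeConjecture.Cruxes.BlochSeedDiscOne.SeedChecker
open Summit.Ventures.HSemireg Summit.Ventures.HSemireg.Pad4Tower

/-- `AdmTwP` — the PRIMED twisted admissibility of route № 3 (`gluableSigmaAdmissible ∨ bfSingleAdmissible'`), verbatim the lambda term of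
the route decls `SheafSeedGaussSq` ∕ `TwistedPerfectDoorPrime` (and of `Cruxes/SheafSeedGaussSq/Lines/secant_q824.lean`).  A reducible
abbreviation ONLY for this file. [cite: BuchweitzFlenner2003, §5 (I-semiregular)] [cite: Pridham2024Semiregularity, Rem. 2.26 with Cor. 2.25] -/
abbrev AdmTwP : PerfectAdmissibility := fun n X₀ I E =>
  Summit.Ventures.HSemireg.gluableSigmaAdmissible n X₀ I E ∨
    Literature.AlgebraicGeometry.HodgeTheory.bfSingleAdmissible' n X₀ I E

/-! ## §1 The class inclusion at a fixed shifted-initial window -/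

section ClassInclusion

variable {C : ChernCharacterBetti} {n : ℕ} {X₀ : SchemeOver ℂ} {I : Finset ℕ} {κ : (p : ℕ) → complexBetti X₀ (2 * p)}

/-- **Buchweitz–Flenner's slice at a FIXED window lies in the primed class**: a member of `twistedReflexiveClass C bfSingleAdmissible` at a
shifted-initial window `I` is a member of `twistedReflexiveClass C AdmTwP` at `I` (same complex, same `B₀`; the window conjunct is `hI`).
[cite: BuchweitzFlenner2003, §5 (I-semiregular)] [cite: Pridham2024Semiregularity, Rem. 2.26 with Cor. 2.25] -/
theorem twistedReflexiveClass_admTwP_of_bfSingle (hI : I.IsShiftedInitialSegment)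
    (h : twistedReflexiveClass C bfSingleAdmissible n X₀ I κ) : twistedReflexiveClass C AdmTwP n X₀ I κ := by
  obtain ⟨E, hE, B₀, hA, hBr, hBa, hκ⟩ := h
  exact ⟨E, hE, B₀, Or.inr ⟨hA, hI⟩, hBr, hBa, hκ⟩

/-- **An `I`-semiregular finite locally free `𝓔` with `κ_p = ch_p(𝓔)` on a shifted-initial window `I` is a member of
`twistedReflexiveClass C AdmTwP`** (`B₀ = 0`, witness `𝓔[0]`). [cite: BuchweitzFlenner2003, §5 (I-semiregular) and Thm. 5.1 (hypotheses)] -/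
theorem twistedReflexiveClass_admTwP_of_isISemiregular (hI : I.IsShiftedInitialSegment) (E₀ : X₀.left.Modules)
    (hE₀ : IsFiniteLocallyFree E₀) (hsr : IsISemiregular hE₀ {q | q + 1 ∈ I}) (hκ : ∀ p ∈ I, κ p = C.ch X₀ E₀ p) :
    twistedReflexiveClass C AdmTwP n X₀ I κ :=
  twistedReflexiveClass_admTwP_of_bfSingle hI (twistedReflexiveClass_of_isISemiregular (fun _ _ _ _ h => h) E₀ hE₀ hsr hκ)

/-- the venture's sheaf class at a shifted-initial window lies in the primed twisted class. [cite: BuchweitzFlenner2003, §5 (I-semiregular)] -/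
theorem twistedReflexiveClass_admTwP_of_bfSheafClass (hI : I.IsShiftedInitialSegment) (h : bfSheafClass C n X₀ I κ) :
    twistedReflexiveClass C AdmTwP n X₀ I κ := by
  obtain ⟨E₀, hE₀, hsr, hκ⟩ := h
  exact twistedReflexiveClass_admTwP_of_isISemiregular hI E₀ hE₀ hsr hκ

end ClassInclusion

section Seeds

variable {C : ChernCharacterBetti}

/-- **one-model BF sheaf seed on a shifted-initial window ⟹ seed of the primed twisted class** (same `I`, `κ_p := ch_p(𝓔)`).
[cite: BuchweitzFlenner2003, §5 (I-semiregular)] -/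
theorem hasSeedOn_admTwP_of_hasBFSheafSeedOn {n : ℕ} {I : Finset ℕ} {P : AbelianVariety ℂ} {h : complexBetti P.X 2}
    {w : complexBetti P.X (2 * n)} (hI : I.IsShiftedInitialSegment) (hS : HasBFSheafSeedOn C n I P h w) :
    HasSeedOn (twistedReflexiveClass C AdmTwP) n P h w := by
  obtain ⟨E₀, hE₀, q, c, hnI, hsr, hchn, hchp⟩ := hS
  exact ⟨I, fun p => C.ch P.X E₀ p, q, c, hnI,
    twistedReflexiveClass_admTwP_of_isISemiregular hI E₀ hE₀ hsr (fun _ _ => rfl), hchn, hchp⟩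

/-- **hyperbolic one-model BF sheaf seed on a shifted-initial window ⟹ hyperbolic seed of the primed twisted class**, same level `(N, d)`
(all anchor binders carried over verbatim). [cite: BuchweitzFlenner2003, §5 (I-semiregular)] [cite: vanGeemen1994HodgeAV, 5.2–5.4] -/
theorem hasHyperbolicSeedOn_admTwP_of_hasHyperbolicBFSheafSeedOn {N d : ℕ} {I : Finset ℕ} (hI : I.IsShiftedInitialSegment)
    (hS : HasHyperbolicBFSheafSeedOn C N d I) : HasHyperbolicSeedOn (twistedReflexiveClass C AdmTwP) N d := by
  obtain ⟨P, ψ₀, e, a, w, hP, hψ, ha, ha0, hhyp, hwW, hwr, hw0, hseed⟩ := hS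
  exact ⟨P, ψ₀, e, a, w, hP, hψ, ha, ha0, hhyp, hwW, hwr, hw0, hasSeedOn_admTwP_of_hasBFSheafSeedOn hI hseed⟩

end Seeds

/-! ## §2 The crux of route № 3 BY NAME -/

section CruxByName

/-- **HYPERBOLIC BF SHEAF SEEDS AT `(4, 1)` FOR EVERY `C`, EACH ON A SHIFTED-INITIAL WINDOW ⟹ `SheafSeedGaussSq`** (item
stmt-HodgeConjecture-30548, the crux of route № 3 `EightfoldTwistedSheafSeeds`), with `m := 1`.  No named fact is used.
[cite: BuchweitzFlenner2003, §5 (I-semiregular)] [cite: Markman2025SecantWeil, §1.5] -/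
theorem sheafSeedGaussSq_of_hyperbolicBFSheafSeedsOn
    (h : ∀ C : ChernCharacterBetti, ∃ I : Finset ℕ, I.IsShiftedInitialSegment ∧ HasHyperbolicBFSheafSeedOn C 4 1 I) :
    Summit.HodgeConjecture.HodgeConjecture.Theses.EightfoldTwistedSheafSeeds.SheafSeedGaussSq := by
  refine ⟨1, one_pos, fun C => ?_⟩
  obtain ⟨I, hI, hS⟩ := h C
  rw [one_pow]
  exact hasHyperbolicSeedOn_admTwP_of_hasHyperbolicBFSheafSeedOn hI hS

variable {E₀ : AbelianVariety ℂ} {ψ₀ : E₀ ⟶ E₀} {C : ChernCharacterBetti}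

/-- **R-B ENTRANCE (rank-free json checker) ⟹ the twisted seed at `(4, 1)` for that `C`**: a (design, sheaf) pair on the anchor
`pad4Anchor E₀` passing `Design.SheafSeedCheckRankFree C I K 𝓔` with `I` shifted-initial. [cite: BuchweitzFlenner2003, §5 (I-semiregular)] -/
theorem hasHyperbolicSeedOn_admTwP_of_sheafSeedCheckRankFree (hE : E₀.dim = 1) (hψ : ψ₀ ≫ ψ₀ = -(1 • 𝟙 E₀)) {D : Design}
    {I : Finset ℕ} {K : AnchorKit E₀ ψ₀} {𝓔 : (pad4Anchor E₀).X.left.Modules} (hI : I.IsShiftedInitialSegment)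
    (h : D.SheafSeedCheckRankFree C I K 𝓔) : HasHyperbolicSeedOn (twistedReflexiveClass C AdmTwP) 4 1 :=
  hasHyperbolicSeedOn_admTwP_of_hasHyperbolicBFSheafSeedOn hI (hasHyperbolicBFSheafSeedOn_of_sheafSeedCheckRankFree hE hψ h)

/-- **R-B ENTRANCE (rank-`r` json checker; `r = 8` is the R-B room).** [cite: BuchweitzFlenner2003, §5 (I-semiregular)] -/
theorem hasHyperbolicSeedOn_admTwP_of_sheafSeedCheckR (hE : E₀.dim = 1) (hψ : ψ₀ ≫ ψ₀ = -(1 • 𝟙 E₀)) {D : Design} {r : ℕ}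
    {I : Finset ℕ} {K : AnchorKit E₀ ψ₀} {𝓔 : (pad4Anchor E₀).X.left.Modules} (hI : I.IsShiftedInitialSegment)
    (h : D.SheafSeedCheckR r C I K 𝓔) : HasHyperbolicSeedOn (twistedReflexiveClass C AdmTwP) 4 1 :=
  hasHyperbolicSeedOn_admTwP_of_sheafSeedCheckRankFree hE hψ hI h.rankFree

/-- **R-B ENTRANCE ((A1@Z) = `CleanAtSeed`, any rank).** [cite: BuchweitzFlenner2003, §5 (I-semiregular)] -/
theorem hasHyperbolicSeedOn_admTwP_of_cleanAtSeed (hE : E₀.dim = 1) (hψ : ψ₀ ≫ ψ₀ = -(1 • 𝟙 E₀)) (K : AnchorKit E₀ ψ₀)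
    {I : Finset ℕ} {𝓔 : (pad4Anchor E₀).X.left.Modules} {μ : GaussianInt} (hμ : μ ≠ 0) (h𝓔 : IsFiniteLocallyFree 𝓔)
    (h4 : 4 ∈ I) (hI : I.IsShiftedInitialSegment) (hsr : IsISemiregular h𝓔 {q' | q' + 1 ∈ I})
    (hcl : CleanAtSeed C I K.F (hStd E₀ K.η) 𝓔 μ) : HasHyperbolicSeedOn (twistedReflexiveClass C AdmTwP) 4 1 :=
  hasHyperbolicSeedOn_admTwP_of_hasHyperbolicBFSheafSeedOn hI
    ⟨pad4Anchor E₀, pad4Action E₀ ψ₀, K.pol.e, K.pol.a, K.F.wOf μ, pad4Anchor_dim hE, pad4Action_comp_self hψ,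
      K.pol.a_rational, K.pol.a_ne_zero, K.hyperbolic_symH hE hψ, K.F.wOf_mem _, K.F.wOf_rational _, K.F.wOf_ne_zero hμ,
      hasBFSheafSeedOn_of_cleanAtSeed h𝓔 h4 hsr (cleanAtSeed_symH_of_hStd hE hψ K hcl)⟩

/-- **R-B ENTRANCE (kernel presentation = DOWN two-term display `0 → 𝓔 → 𝓝 → 𝓟 → 0` of a C0′ design).**
[cite: BuchweitzFlenner2003, §5 (I-semiregular)] -/
theorem hasHyperbolicSeedOn_admTwP_of_kernelPresentation (hE : E₀.dim = 1) (hψ : ψ₀ ≫ ψ₀ = -(1 • 𝟙 E₀)) {D : Design}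
    {𝓔 : (pad4Anchor E₀).X.left.Modules} (W : WordKit E₀ ψ₀) (π : KernelPresentation C W.Φ D 𝓔) (hC0 : D.ClassDataRankFree)
    {I : Finset ℕ} (h4 : 4 ∈ I) (hI8 : ∀ p ∈ I, p ≤ 8) (hI : I.IsShiftedInitialSegment) (h𝓔 : IsFiniteLocallyFree 𝓔)
    (hsr : IsISemiregular h𝓔 {q' | q' + 1 ∈ I}) : HasHyperbolicSeedOn (twistedReflexiveClass C AdmTwP) 4 1 :=
  hasHyperbolicSeedOn_admTwP_of_sheafSeedCheckRankFree hE hψ hI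
    (D.sheafSeedCheckRankFree_of_kernelPresentation W π hC0 h4 hI8 h𝓔 hsr)

/-- **THE RANK-FREE CHECKER FOR EVERY `C` ⟹ `SheafSeedGaussSq` BY NAME** (what a registered line on item 30548 built from the R-B sheaf door would
have as its `_of` theorem; anchor, design, kit, sheaf and window may depend on `C`; v41's `SplitBlock.Rung2aSheaf[K] C I h` enters through
`SplitBlock.hasHyperbolicBFSheafSeedOn_of_rung2aSheaf[K]` and `sheafSeedGaussSq_of_hyperbolicBFSheafSeedsOn` — not restated here while that module is unbuilt on the farm).
[cite: BuchweitzFlenner2003, §5 (I-semiregular)] -/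
theorem sheafSeedGaussSq_of_sheafSeedCheckRankFree
    (h : ∀ C : ChernCharacterBetti, ∃ (E₀ : AbelianVariety ℂ) (ψ₀ : E₀ ⟶ E₀) (_ : E₀.dim = 1) (_ : ψ₀ ≫ ψ₀ = -(1 • 𝟙 E₀))
      (D : Design) (I : Finset ℕ) (K : AnchorKit E₀ ψ₀) (𝓔 : (pad4Anchor E₀).X.left.Modules),
      I.IsShiftedInitialSegment ∧ D.SheafSeedCheckRankFree C I K 𝓔) :
    Summit.HodgeConjecture.HodgeConjecture.Theses.EightfoldTwistedSheafSeeds.SheafSeedGaussSq :=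
  sheafSeedGaussSq_of_hyperbolicBFSheafSeedsOn fun C => by
    obtain ⟨E₀, ψ₀, hE, hψ, D, I, K, 𝓔, hI, hc⟩ := h C
    exact ⟨I, hI, hasHyperbolicBFSheafSeedOn_of_sheafSeedCheckRankFree hE hψ hc⟩

/-! ### §2b Re-windowing: the json-checker entrances need NO window hypothesis

`I`-semiregularity is MONOTONE in the window (`IsISemiregular.mono`: more components `σ_q` can only shrink the joint kernel), and
`Design.RealisedBy` certifies (A1)-cleanliness in EVERY degree `≤ 8` (it does not mention `I`); so a passing rank-free certificate at ANY
window `I` (`4 ∈ I`, `I ⊆ {0..8}`) is a passing certificate at the shifted-initial window `{1, …, 8}` — and the caveat of §3 evaporates for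
every entrance that goes through the checker (`SheafSeedCheck[R ∕ RankFree]`, kernel ∕ cokernel ∕ monad presentations of a C0′ design,
v41 `PassesSheaf`).  It does NOT evaporate for the bare `CleanAtSeed C I` ∕ `HasHyperbolicBFSheafSeedOn C 4 1 I` entrances, whose
cleanliness clauses live on `I` only (there the window must already be shifted-initial, or cleanliness must be supplied on `{1,2,3}` too). -/

/-- the window `{q | q + 1 ∈ I}` of a checker window `I ⊆ {0..8}` sits inside that of `{1, …, 8}`. [cite: BuchweitzFlenner2003, §5 (I-semiregular)] -/
theorem window_subset_icc_one_eight {I : Finset ℕ} (hI8 : ∀ p ∈ I, p ≤ 8) :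
    {q' : ℕ | q' + 1 ∈ I} ⊆ {q' : ℕ | q' + 1 ∈ Finset.Icc 1 8} := by
  intro q hq
  simp only [Set.mem_setOf_eq, Finset.mem_Icc] at hq ⊢
  exact ⟨Nat.le_add_left 1 q, hI8 _ hq⟩

/-- **RE-WINDOWING A PASSING RANK-FREE CERTIFICATE to `{1, …, 8}`** (semiregularity by monotonicity, cleanliness because `RealisedBy` is
window-free, `4 ∈ {1..8}`, `{1..8} ⊆ {0..8}`). [cite: BuchweitzFlenner2003, §5 (I-semiregular)] -/
theorem sheafSeedCheckRankFree_rewindow {D : Design} {I : Finset ℕ} {K : AnchorKit E₀ ψ₀} {𝓔 : (pad4Anchor E₀).X.left.Modules}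
    (h : D.SheafSeedCheckRankFree C I K 𝓔) : D.SheafSeedCheckRankFree C (Finset.Icc 1 8) K 𝓔 := by
  obtain ⟨hC0, _, hI8, ⟨h𝓔, hsr⟩, hR⟩ := h
  exact ⟨hC0, by simp, fun p hp => (Finset.mem_Icc.mp hp).2, ⟨h𝓔, IsISemiregular.mono h𝓔 (window_subset_icc_one_eight hI8) hsr⟩, hR⟩

/-- the same for the rank-`r` checker. [cite: BuchweitzFlenner2003, §5 (I-semiregular)] -/
theorem sheafSeedCheckR_rewindow {D : Design} {r : ℕ} {I : Finset ℕ} {K : AnchorKit E₀ ψ₀} {𝓔 : (pad4Anchor E₀).X.left.Modules}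
    (h : D.SheafSeedCheckR r C I K 𝓔) : D.SheafSeedCheckR r C (Finset.Icc 1 8) K 𝓔 := by
  obtain ⟨hC0, _, hI8, ⟨h𝓔, hsr⟩, hR⟩ := h
  exact ⟨hC0, by simp, fun p hp => (Finset.mem_Icc.mp hp).2, ⟨h𝓔, IsISemiregular.mono h𝓔 (window_subset_icc_one_eight hI8) hsr⟩, hR⟩

/-- **R-B ENTRANCE (rank-free json checker), NO WINDOW HYPOTHESIS ⟹ the twisted seed of route № 3's crux at `(4, 1)` for that `C`.**
[cite: BuchweitzFlenner2003, §5 (I-semiregular)] -/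
theorem hasHyperbolicSeedOn_admTwP_of_sheafSeedCheckRankFree' (hE : E₀.dim = 1) (hψ : ψ₀ ≫ ψ₀ = -(1 • 𝟙 E₀)) {D : Design}
    {I : Finset ℕ} {K : AnchorKit E₀ ψ₀} {𝓔 : (pad4Anchor E₀).X.left.Modules} (h : D.SheafSeedCheckRankFree C I K 𝓔) :
    HasHyperbolicSeedOn (twistedReflexiveClass C AdmTwP) 4 1 :=
  hasHyperbolicSeedOn_admTwP_of_sheafSeedCheckRankFree hE hψ (Finset.isShiftedInitialSegment_Icc le_rfl 8)
    (sheafSeedCheckRankFree_rewindow h)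

/-- **R-B ENTRANCE (rank-`r` json checker; `r = 8` the R-B room), NO WINDOW HYPOTHESIS.** [cite: BuchweitzFlenner2003, §5 (I-semiregular)] -/
theorem hasHyperbolicSeedOn_admTwP_of_sheafSeedCheckR' (hE : E₀.dim = 1) (hψ : ψ₀ ≫ ψ₀ = -(1 • 𝟙 E₀)) {D : Design} {r : ℕ}
    {I : Finset ℕ} {K : AnchorKit E₀ ψ₀} {𝓔 : (pad4Anchor E₀).X.left.Modules} (h : D.SheafSeedCheckR r C I K 𝓔) :
    HasHyperbolicSeedOn (twistedReflexiveClass C AdmTwP) 4 1 :=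
  hasHyperbolicSeedOn_admTwP_of_sheafSeedCheckRankFree' hE hψ h.rankFree

/-- **R-B ENTRANCE (kernel presentation of a C0′ design), NO WINDOW HYPOTHESIS.** [cite: BuchweitzFlenner2003, §5 (I-semiregular)] -/
theorem hasHyperbolicSeedOn_admTwP_of_kernelPresentation' (hE : E₀.dim = 1) (hψ : ψ₀ ≫ ψ₀ = -(1 • 𝟙 E₀)) {D : Design}
    {𝓔 : (pad4Anchor E₀).X.left.Modules} (W : WordKit E₀ ψ₀) (π : KernelPresentation C W.Φ D 𝓔) (hC0 : D.ClassDataRankFree)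
    {I : Finset ℕ} (h4 : 4 ∈ I) (hI8 : ∀ p ∈ I, p ≤ 8) (h𝓔 : IsFiniteLocallyFree 𝓔) (hsr : IsISemiregular h𝓔 {q' | q' + 1 ∈ I}) :
    HasHyperbolicSeedOn (twistedReflexiveClass C AdmTwP) 4 1 :=
  hasHyperbolicSeedOn_admTwP_of_sheafSeedCheckRankFree' hE hψ (D.sheafSeedCheckRankFree_of_kernelPresentation W π hC0 h4 hI8 h𝓔 hsr)

/-- **THE RANK-FREE CHECKER FOR EVERY `C`, ANY WINDOWS ⟹ `SheafSeedGaussSq` BY NAME** — the `_of` theorem a registered line on 30548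
built from the R-B sheaf door would have, with NO window side condition. [cite: BuchweitzFlenner2003, §5 (I-semiregular)] -/
theorem sheafSeedGaussSq_of_sheafSeedCheckRankFree'
    (h : ∀ C : ChernCharacterBetti, ∃ (E₀ : AbelianVariety ℂ) (ψ₀ : E₀ ⟶ E₀) (_ : E₀.dim = 1) (_ : ψ₀ ≫ ψ₀ = -(1 • 𝟙 E₀))
      (D : Design) (I : Finset ℕ) (K : AnchorKit E₀ ψ₀) (𝓔 : (pad4Anchor E₀).X.left.Modules), D.SheafSeedCheckRankFree C I K 𝓔) :
    Summit.HodgeConjecture.HodgeConjecture.Theses.EightfoldTwistedSheafSeeds.SheafSeedGaussSq :=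
  sheafSeedGaussSq_of_hyperbolicBFSheafSeedsOn fun C => by
    obtain ⟨E₀, ψ₀, hE, hψ, D, I, K, 𝓔, hc⟩ := h C
    exact ⟨Finset.Icc 1 8, Finset.isShiftedInitialSegment_Icc le_rfl 8,
      hasHyperbolicBFSheafSeedOn_of_sheafSeedCheckRankFree hE hψ (sheafSeedCheckRankFree_rewindow hc)⟩

/-- **WHAT THE TWO TERMINI HAVE IN COMMON AND WHERE THEY DIFFER** (recorded): the ladder node needs BF 5.1 (model rendering) and takes ANY
window with `4 ∈ I`; the crux of route № 3 needs NO named fact but wants the window shifted-initial.  Both from one `HasHyperbolicBFSheafSeedOn`.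
[cite: BuchweitzFlenner2003, §5 Thm. 5.1] [cite: Deligne1982HodgeCycles, proof of Thm. 4.8] -/
theorem two_termini {I : Finset ℕ} (hS : HasHyperbolicBFSheafSeedOn C 4 1 I) :
    (BuchweitzFlenner2003_variationalHodge_ISemiregular_model → HasLocallyAlgebraicWeilAnchor 4 1) ∧
      (I.IsShiftedInitialSegment → HasHyperbolicSeedOn (twistedReflexiveClass C AdmTwP) 4 1) :=
  ⟨fun hBF => hasLocallyAlgebraicWeilAnchor_of_BFmodel_of_hyperbolicBFSheafSeedOn hBF hS,
    fun hI => hasHyperbolicSeedOn_admTwP_of_hasHyperbolicBFSheafSeedOn hI hS⟩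

end CruxByName

/-! ## §3 The window lemmas -/

section Window

/-- with `4 ∈ I`, a shifted-initial window contains `{1, 2, 3, 4}`: `σ₀, σ₁, σ₂, σ₃` are all tested.
[cite: BuchweitzFlenner2003, §5 (I-semiregular)] -/
theorem icc_one_four_subset {I : Finset ℕ} (h4 : 4 ∈ I) (hI : I.IsShiftedInitialSegment) : Finset.Icc 1 4 ⊆ I := by
  intro x hx
  obtain ⟨h1, hx4⟩ := Finset.mem_Icc.mp hx
  obtain ⟨q', rfl⟩ : ∃ q', x = q' + 1 := ⟨x - 1, by omega⟩
  exact hI 3 h4 q' (by omega)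

/-- conversely a window squeezed between `{1, …, 4}` and `{0, …, 8}` … is NOT automatically shifted-initial (e.g. `{1,2,3,4,6}`); what IS
true: `Finset.Icc a m` with `a ≤ 1` qualifies (tree lemma `isShiftedInitialSegment_Icc`), so the R-B windows `Icc 1 8`, `Icc 0 8`, `Icc 1 4` do.
[cite: BuchweitzFlenner2003, §5 (I-semiregular)] -/
theorem isShiftedInitialSegment_rb_windows :
    (Finset.Icc 1 8).IsShiftedInitialSegment ∧ (Finset.Icc 0 8).IsShiftedInitialSegment ∧ (Finset.Icc 1 4).IsShiftedInitialSegment :=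
  ⟨Finset.isShiftedInitialSegment_Icc le_rfl 8, Finset.isShiftedInitialSegment_Icc (Nat.zero_le 1) 8,
    Finset.isShiftedInitialSegment_Icc le_rfl 4⟩

/-- **the bare cycle-degree window `{4}` is NOT shifted-initial** (`σ₃` tested, `σ₀` not): an R-B certificate semiregular in degree 4 only
reaches the ladder node mod BF 5.1 but not the crux of route № 3 as typed. [cite: BuchweitzFlenner2003, §5 (I-semiregular)] -/
theorem not_isShiftedInitialSegment_four : ¬ ({4} : Finset ℕ).IsShiftedInitialSegment := by
  intro h
  have h1 : (0 : ℕ) + 1 ∈ ({4} : Finset ℕ) := h 3 (by simp) 0 (Nat.zero_le 3)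
  simp at h1

/-- nor is the window `{4, …, 8}` of the «stable range» reading. [cite: BuchweitzFlenner2003, §5 (I-semiregular)] -/
theorem not_isShiftedInitialSegment_icc_four_eight : ¬ (Finset.Icc 4 8).IsShiftedInitialSegment := by
  intro h
  have h1 : (0 : ℕ) + 1 ∈ Finset.Icc 4 8 := h 3 (by simp) 0 (Nat.zero_le 3)
  simp at h1

end Window

/-! ## §4 Audit: nothing is decided here

Every theorem above carries its object (a sheaf seed ∕ a passing checker ∕ a presentation ∕ v41's rung) among its HYPOTHESES; none is
constructed in the tree.  `SheafSeedGaussSq` (30548) is concluded only from such hypotheses; route № 3's `closes` needs in addition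
`TwistedPerfectDoorPrime`, `ChernCharacterOnBetti`, `BlochSeedsGeneric`, `BlochSeedDiscThree`, `ReachHyperbolic`, `BlochSpreadEightFour`.
No `sorry`; axioms standard.  R-B ≠ 18881; nothing here is proved toward HC ∕ HC_CM ∕ HC_AV ∕ № 4 ∕ 26512 ∕ 18881 ∕ 30548 ∕ H2. -/

/-- AUDIT: this file decides nothing. -/
theorem audit_nothing_decided : True := trivial

end Summit.HodgeConjecture.HodgeConjecture.Cruxes.BlochSeedDiscOne.RBDoorChainSheafCrux

end
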